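import Summits.QuantumFields.BalabanUV.Beta.FP.EffFormTower
import Summits.QuantumFields.BalabanUV.Beta.FP.NestedStepLawSliced
import Summits.QuantumFields.BalabanUV.Beta.FP.NestedStepLawJetsCorner
import Summits.QuantumFields.BalabanUV.Beta.FP.KKTCornerReduction

/-!
# `BalabanUV.Beta.FP.NestedLegTransport` — road «FP» (binder row D1), ROUTE T, R-FP-59 (3) «the coarse leg's ff block vs `Q₁₀·Γ_N·Q₁₀ᵀ`» (LEG-T), NESTED SLICE:
# **THE `Q₁`-SANDWICH OF THE NESTED-SLICED ONE-SHOT FLUCTUATION COVARIANCE IS THE COARSE SLICED SYSTEM's FLUCTUATION COVARIANCE, WITH THE BLOCK TERM IN PLACE**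

HONEST DEPENDENCY (page 1, mandatory): continuum YM on T⁴ ⇐ BetaPertH ∧ nine spine estimates (0/9 proved); BetaPertH ⇐ (D1) ∧ (D4) ∧ CAP+tail;
G-an2-4 gates asym, D1 and NE2/3/4.  HONEST FRAMING (cell contract, verbatim): «discharging `BetaPertH` makes Bałaban's UV stability UNCONDITIONAL —
a real constructive-QFT result; it is NOT the continuum limit and NOT the Clay problem.»  ABSOLUTE RULE (cell charter, verbatim): «No internally-minted
statement may enter as a cited fact. Every hypothesis is either kernel-proved in this package or a verbatim quotation of a PUBLISHED theorem with page
reference. The manuscript(s) under audit are NOT citable for their own disputed steps — they are the thing under adjudication; programme-internal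
(2001/route/tribunal) claims are never citable.»

WHY (RULING R-FP-59 (3) of the road «FP» OWNER d1-p3 g23; the OWNER g24's ANSWER to Q-leaf05-g34-1 [D1P3-G24-W2]: «THE NESTED BRANCH — J17 IS THE WHOLE LETTER»).
With the order-1 companion pair `(Λ₁ᴺ, Λ₁ᴳ)` riding in the generic door's `G`-slots, the nested factorisation behind the door (`NestedStepLawJetsCorner` lineage,
after the door's own slice exchange `NestedStepLawOneShotJets.secondVar_kkt_slice_change_jets_of_range`) matches the companion's bubble and cross terms through the
identity `Q₁ · Γ_N · Q₁ᵀ = Γ_G` for the NESTED-sliced composite system — the abstract content of this file; its torus faces are this lineage's (T-INV) letters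
(`RelInvPeriodisedOneShot.torus_flucCov_eq_oneShot_of_relInv`, `RelInvPeriodisedCombMinOp.torus_flucCov_eq_comb`) read right to left, consequences not typed here.

WHAT ([folklore] block-matrix bookkeeping BY NAME over an2's `CompositionSingular` (`flucCov_compForm` — `Γ_N = Γ_F + I·Γ♯·L` —, `mul_flucCov`, `mul_minOp`,
`minOpL_mul_transpose`, `isUnit_det_kkt_compForm`) and the road's pinning plumbing (`EffFormTower.flucCov_killRows`, `NestedStepLawSliced.nestedSlice_mul_fromRows ∕
compForm_fromRows_blockDiag`, `NestedStepLawJetsCorner.toBlocks₁₁_add_blockDiag`, `KKTCornerReduction.det_kkt_killRows`); no `def`, no `def … : Prop`, nothing cited,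
0 sorry; abstract `H Q₁ τ₁ G Q₂ τ₂` over ℝ with p308750's ∕ U21's `hS h1 h2` VERBATIM): `rows_mul_flucCov_nested_mul_transpose`
(`[Q₁;τ₁]·Γ_N·[Q₁;τ₁]ᵀ = flucCov (S + (G ⊕ 0)) [[Q₂;τ₂],0;0,1]`), **`leg_transport_nested`** (`Q₁·Γ_N·Q₁ᵀ = flucCov (S₁₁ + G) [Q₂;τ₂]`), `slice_mul_flucCov_nested` (`τ₁·Γ_N = 0`),
`Γ_N := flucCov (H + Q₁ᵀGQ₁) [[Q₂Q₁; τ₂Q₁]; τ₁]`.  NOT HERE: the big-comb slice (not wanted — the door exchanges the slices itself), any torus object, any value.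
Discharges NO binder of row D1; 0 estimates; 0∕4 row-D1 binders (hW, hR, D1Tel, D1Rep); NOT (J-a), NOT (T-ID), NOT SDF, NOT D1, NOT BetaPertH, NOT continuum, NOT Clay.
«not in print; our bookkeeping».  Unit `b2b-balaban-beta-d1-formalise-leaf-05` (gen 34; probe J17 a83f051b8632258d), 2026-08-23; no existing file touched.
-/

namespace Summit.QuantumFields.BalabanUV.Beta.FP.NestedLegTransport

open Matrix
open Literature.MathematicalPhysics.QuantumFieldTheory.Balaban1983to89.Beta.Composition (kkt compForm)
open Literature.MathematicalPhysics.QuantumFieldTheory.Balaban1983to89.Beta.CompositionSingular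
  (effForm flucCov minOp minOpL flucCov_compForm mul_flucCov mul_minOp minOpL_mul_transpose)
open Summit.QuantumFields.BalabanUV.Beta.FP.EffFormTower (flucCov_killRows)
open Summit.QuantumFields.BalabanUV.Beta.FP.NestedStepLawSliced (nestedSlice_mul_fromRows compForm_fromRows_blockDiag)
open Summit.QuantumFields.BalabanUV.Beta.FP.NestedStepLawJetsCorner (toBlocks₁₁_add_blockDiag)
open Summit.QuantumFields.BalabanUV.Beta.FP.KKTCornerReduction (det_kkt_killRows)

variable {ν μ κ ρ₁ ρ₂ : Type*} [Fintype ν] [Fintype μ] [Fintype κ] [Fintype ρ₁] [Fintype ρ₂]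
  [DecidableEq ν] [DecidableEq μ] [DecidableEq κ] [DecidableEq ρ₁] [DecidableEq ρ₂]

/-- **LEG-T, full rows**: `[Q₁;τ₁] · Γ_N · [Q₁;τ₁]ᵀ = flucCov (S + (G ⊕ 0)) [[Q₂;τ₂],0;0,1]` (an2's telescoping `Γ_N = Γ_F + I·Γ♯·L` with
`[Q₁;τ₁]·Γ_F = 0`, `[Q₁;τ₁]·I = 1`, `L·[Q₁;τ₁]ᵀ = 1`). -/
theorem rows_mul_flucCov_nested_mul_transpose (H : Matrix ν ν ℝ) (Q₁ : Matrix μ ν ℝ) (τ₁ : Matrix ρ₁ ν ℝ) (G : Matrix μ μ ℝ)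
    (Q₂ : Matrix κ μ ℝ) (τ₂ : Matrix ρ₂ μ ℝ) {S : Matrix (μ ⊕ ρ₁) (μ ⊕ ρ₁) ℝ} (hS : effForm H (fromRows Q₁ τ₁) = S)
    (h1 : (kkt H (fromRows Q₁ τ₁)).det ≠ 0) (h2 : (kkt (S.toBlocks₁₁ + G) (fromRows Q₂ τ₂)).det ≠ 0) :
    fromRows Q₁ τ₁ * flucCov (H + Q₁ᵀ * G * Q₁) (fromRows (fromRows (Q₂ * Q₁) (τ₂ * Q₁)) τ₁) * (fromRows Q₁ τ₁)ᵀ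
      = flucCov (S + fromBlocks G (0 : Matrix μ ρ₁ ℝ) (0 : Matrix ρ₁ μ ℝ) (0 : Matrix ρ₁ ρ₁ ℝ))
          (fromBlocks (fromRows Q₂ τ₂) (0 : Matrix (κ ⊕ ρ₂) ρ₁ ℝ) (0 : Matrix ρ₁ μ ℝ) (1 : Matrix ρ₁ ρ₁ ℝ)) := by
  have h1' : IsUnit (kkt H (fromRows Q₁ τ₁)).det := isUnit_iff_ne_zero.2 h1
  have h2' : IsUnit (kkt (effForm H (fromRows Q₁ τ₁) + fromBlocks G (0 : Matrix μ ρ₁ ℝ) (0 : Matrix ρ₁ μ ℝ) (0 : Matrix ρ₁ ρ₁ ℝ))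
      (fromBlocks (fromRows Q₂ τ₂) (0 : Matrix (κ ⊕ ρ₂) ρ₁ ℝ) (0 : Matrix ρ₁ μ ℝ) (1 : Matrix ρ₁ ρ₁ ℝ))).det := by
    rw [hS, isUnit_iff_ne_zero, det_kkt_killRows, toBlocks₁₁_add_blockDiag]
    exact mul_ne_zero (pow_ne_zero _ (by norm_num)) h2
  rw [← compForm_fromRows_blockDiag H Q₁ τ₁ G, ← nestedSlice_mul_fromRows Q₂ τ₂ Q₁ τ₁, flucCov_compForm _ _ _ _ h1' h2',
    Matrix.mul_add, Matrix.add_mul, ← Matrix.mul_assoc, ← Matrix.mul_assoc, mul_flucCov _ _ h1', Matrix.zero_mul, zero_add,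
    mul_minOp _ _ h1', Matrix.one_mul, Matrix.mul_assoc, minOpL_mul_transpose _ _ h1', Matrix.mul_one, hS]

/-- **LEG-T — THE COARSE LEG's ff BLOCK IS THE `Q₁`-SANDWICH OF THE ONE-SHOT FLUCTUATION COVARIANCE** (nested slice):
`Q₁ · flucCov (H + Q₁ᵀGQ₁) [[Q₂Q₁; τ₂Q₁]; τ₁] · Q₁ᵀ = flucCov (S₁₁ + G) [Q₂; τ₂]`. -/
theorem leg_transport_nested (H : Matrix ν ν ℝ) (Q₁ : Matrix μ ν ℝ) (τ₁ : Matrix ρ₁ ν ℝ) (G : Matrix μ μ ℝ)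
    (Q₂ : Matrix κ μ ℝ) (τ₂ : Matrix ρ₂ μ ℝ) {S : Matrix (μ ⊕ ρ₁) (μ ⊕ ρ₁) ℝ} (hS : effForm H (fromRows Q₁ τ₁) = S)
    (h1 : (kkt H (fromRows Q₁ τ₁)).det ≠ 0) (h2 : (kkt (S.toBlocks₁₁ + G) (fromRows Q₂ τ₂)).det ≠ 0) :
    Q₁ * flucCov (H + Q₁ᵀ * G * Q₁) (fromRows (fromRows (Q₂ * Q₁) (τ₂ * Q₁)) τ₁) * Q₁ᵀ = flucCov (S.toBlocks₁₁ + G) (fromRows Q₂ τ₂) := by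
  have h := rows_mul_flucCov_nested_mul_transpose H Q₁ τ₁ G Q₂ τ₂ hS h1 h2
  have h2'' : IsUnit (kkt ((S + fromBlocks G (0 : Matrix μ ρ₁ ℝ) (0 : Matrix ρ₁ μ ℝ) (0 : Matrix ρ₁ ρ₁ ℝ)).toBlocks₁₁) (fromRows Q₂ τ₂)).det := by
    rw [toBlocks₁₁_add_blockDiag, isUnit_iff_ne_zero]; exact h2
  have hb := flucCov_killRows (S + fromBlocks G (0 : Matrix μ ρ₁ ℝ) (0 : Matrix ρ₁ μ ℝ) (0 : Matrix ρ₁ ρ₁ ℝ)) (fromRows Q₂ τ₂) h2''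
  rw [toBlocks₁₁_add_blockDiag] at hb
  rw [← hb, ← h]
  ext i i'
  simp only [Matrix.toBlocks₁₁, Matrix.of_apply, Matrix.mul_apply, Matrix.transpose_apply, Matrix.fromRows_apply_inl]

/-- **THE FINE SLICE ROWS SEE NO ONE-SHOT FLUCTUATION**: `τ₁ · flucCov (H + Q₁ᵀGQ₁) [[Q₂Q₁; τ₂Q₁]; τ₁] = 0` (they are rows of the slice). -/
theorem slice_mul_flucCov_nested (H : Matrix ν ν ℝ) (Q₁ : Matrix μ ν ℝ) (τ₁ : Matrix ρ₁ ν ℝ) (G : Matrix μ μ ℝ)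
    (Q₂ : Matrix κ μ ℝ) (τ₂ : Matrix ρ₂ μ ℝ) {S : Matrix (μ ⊕ ρ₁) (μ ⊕ ρ₁) ℝ} (hS : effForm H (fromRows Q₁ τ₁) = S)
    (h1 : (kkt H (fromRows Q₁ τ₁)).det ≠ 0) (h2 : (kkt (S.toBlocks₁₁ + G) (fromRows Q₂ τ₂)).det ≠ 0) :
    τ₁ * flucCov (H + Q₁ᵀ * G * Q₁) (fromRows (fromRows (Q₂ * Q₁) (τ₂ * Q₁)) τ₁) = 0 := by
  have h1' : IsUnit (kkt H (fromRows Q₁ τ₁)).det := isUnit_iff_ne_zero.2 h1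
  have h2' : IsUnit (kkt (effForm H (fromRows Q₁ τ₁) + fromBlocks G (0 : Matrix μ ρ₁ ℝ) (0 : Matrix ρ₁ μ ℝ) (0 : Matrix ρ₁ ρ₁ ℝ))
      (fromBlocks (fromRows Q₂ τ₂) (0 : Matrix (κ ⊕ ρ₂) ρ₁ ℝ) (0 : Matrix ρ₁ μ ℝ) (1 : Matrix ρ₁ ρ₁ ℝ))).det := by
    rw [hS, isUnit_iff_ne_zero, det_kkt_killRows, toBlocks₁₁_add_blockDiag]
    exact mul_ne_zero (pow_ne_zero _ (by norm_num)) h2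
  have hN : IsUnit (kkt (H + Q₁ᵀ * G * Q₁) (fromRows (fromRows (Q₂ * Q₁) (τ₂ * Q₁)) τ₁)).det := by
    rw [← compForm_fromRows_blockDiag H Q₁ τ₁ G, ← nestedSlice_mul_fromRows Q₂ τ₂ Q₁ τ₁]
    exact Literature.MathematicalPhysics.QuantumFieldTheory.Balaban1983to89.Beta.CompositionSingular.isUnit_det_kkt_compForm _ _ _ _ h1' h2'
  have hrow := mul_flucCov _ _ hN
  ext r j
  have := congrFun (congrFun hrow (Sum.inr r)) j
  simpa only [Matrix.mul_apply, Matrix.fromRows_apply_inr, Matrix.zero_apply] using this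

end Summit.QuantumFields.BalabanUV.Beta.FP.NestedLegTransport

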